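import Literature.MathematicalPhysics.QuantumFieldTheory.Balaban1983to89.B5Eq114Gauss
import Literature.MathematicalPhysics.QuantumFieldTheory.Balaban1983to89.B5HierGaugeTorus

/-!
# `Balaban1983to89.B5Eq147Landau` — T. Bałaban, *Propagators and renormalization transformations for lattice gauge
# theories. I*, Commun. Math. Phys. **95** (1984) 17–40 [Balaban1984PropagatorsI], Sect. C pp. 24–26: the LANDAU GAUGE
# «δ_R(∂*A)» of (1.38)–(1.41)/(1.46) and **(1.47) PROVED for the k-fold transformation (1.17)** on the typed tower of
# `B5SectBStatements` — `((ST)^k e^{−S})(B) = z″·∫dA δ(B − Q_kA) δ_R(∂*A) exp(−½⟨∂A, ∂A⟩)` for every `k` (d ≥ 2)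

statement-level skeleton of published theorems with citation tags; proofs where landed; nothing here is a claim about the Yang–Mills mass gap

PDF held: `paper:balaban1984-cmp95-propagators-rt-i` (journal page = PDF page + 16); pages read AS IMAGES by this seat:
renders `run/shared/lean/pub/pub-balaban/b2b-balaban-ref1/pages/1984-cmp95-propagators-rt-I/…-p005-x2.png` (p. 21:
(1.21)–(1.24)), `…-p008-x2.png` (p. 24: (1.38)–(1.39)), `…-p009-x2.png` (p. 25: (1.40)–(1.41) and the text on `R`),
`…-p010-x2.png` (p. 26: (1.46)–(1.47)).

CITATION HEADER (lean-in-tree rule).  Cell `lit-balaban` (HOME `run/shared/lean/pub/lit-balaban/`), unit `lit-balaban-p16`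
gen 2 (Phase-2 proof seat p16; `literature-prover-lit-balaban-p16-g2-0`; TAKING 2026-08-21T04:16Z); WHAT IS REPRODUCED =
SKELETON row **B5.Eq1.47** (owner r02: «(1.46)–(1.47) … the integral (1.47) as a typed object: `B5Hk164Transl.int147` …
proved-existing», with the honest-scope note of `B5Hk164Transl` (i) «The identification of `((ST)^k e^{−S})(B)` with the
integral (1.47) — the k-fold renormalization transformation (1.17), the passage from the axial to the Landau gauge
(1.23)/(1.46) — is NOT typed here» and of ROWS-B5 row B5.Eq1.64 «(1.17) = (1.47) not typed») — THIS FILE TYPES AND PROVES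
THAT IDENTIFICATION on r02's tower carrier (`B5SectBStatements.iterST/Qk/Qsk/AxAll/actionEta`, `B5Eq114Gauss`), and
answers the interface question Q-IF2-7 / IF2-25 (tower side; the companion `B5Eq165DeltaK` draws (1.64)/(1.65) for
`B5Eq114Gauss.DeltaK` from it).  Kind «discharge»: the typed claim `Eq147 k` is PROVED for every `k` under the single
hypothesis `2 ≤ d` of `B5Eq114Gauss.eq117_holds`.

WHAT IS PRINTED (verbatim).
* p. 21 [PDF 5]: «where Δ is η-lattice Laplace operator for scalar functions and ∂* is the divergence operator for vector
  functions, ∂*A = Σ_μ ∂*_μA_μ.» and (1.22)/(1.23) (quoted in `B5SectBStatements.fp22/Eq123`).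
* p. 24 [PDF 8]: «Let us denote the projection operator by R, so we have R = I − Δ⁻¹Q′_k*(Q′_kΔ⁻²Q′_k*)⁻¹Q′_kΔ⁻¹. (1.38)
  The gauge fixing density has the form 𝒢_α(∂*A) = (∫dλ δ(Q′_kλ) exp(−(1/2α)‖Δλ‖²))⁻¹ exp(−(1/2α)‖R∂*A‖²), (1.39)».
* p. 25 [PDF 9]: «and from its definition it follows that ∫dλ δ(Q′_kλ)𝒢_α(∂*A^λ) = 1. The projection operator R has a
  clear meaning. It is an orthogonal projection on the linear subspace ΔN(Q′_k) of L²(T_η), N(Q′_k) = {λ : Q′_kλ = 0}.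
  … Let us denote this subspace by R also, R = ΔN(Q′_k).»; (1.40); «so the density 𝒢_α has a limit as α → 0
  𝒢_α(∂*A) ⟶_{α→0} ∣det(Δ↾_{N(Q′_k)})∣δ_R(∂*A), (1.41) where δ_R is a δ-function concentrated at the origin of the
  sub-space R.»; «recall also that the operator Δ is positive definite on N(Q′_k), thus invertible».
* p. 26 [PDF 10]: «The equality (1.23) gives us a composition of k renormalization transformations with the new gauge
  fixing density 𝒢_α. In the sequel it will be convenient to take the limit α → 0, i.e. to consider Landau gauge. We may
  introduce this gauge from the beginning using the equation ∫dλ δ(Q′_kλ)∣det(Δ↾_{N(Q′_k)})∣δ_R(∂*A − Δλ) = 1. (1.46)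
  We have to calculate the integral
  ((ST)^k e^{−S})(B) = z′^{(k)}∣det(Δ↾_{N(Q′_k)})∣∫dA δ(B − Q_kA)δ_R(∂*A) exp(−½⟨∂A, ∂A⟩). (1.47)»

WHAT THIS FILE PROVES (kernel-checked, 0 sorry, axioms ⊆ {propext, Classical.choice, Quot.sound}; Mathlib + the two
imports only).
§1 GENERIC — **exchange of the gauge slice in a δ-integral of linear constraints** (the typed content of «We may
   introduce this gauge from the beginning using the equation (1.46)»): for a constraint map `C`, a subspace `O ≤ N(C)` of
   gauge directions and two subspaces `G₁`, `G₂` each complementary to `O`, every `O`-invariant density has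
   `∫dA δ(B − CA)δ_{G₁}(A)ρ(A) = c·∫dA δ(B − CA)δ_{G₂}(A)ρ(A)` with ONE constant `c > 0` (the Haar scalar factor of the
   projection-along-`O` isomorphism `N(C)∩G₁ ≃ N(C)∩G₂`; `deltaInt_exchange`); r02's `deltaInt` calculus, pattern of
   `B5Eq114Gauss.deltaInt_comp`.
§2 THE LANDAU GAUGE ON THE TOWER (level `k`, `η = L^{−k}`): `Dv k` = «∂* … the divergence operator for vector functions»
   := the adjoint of p37's gradient `B5HierGaugeTorus.Dg k` (= `∂^{L^k}`), with its explicit formula `Dv_apply`;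
   `Lap k = ∂*∂` = «Δ … η-lattice Laplace operator for scalar functions» (1.21) (`Lap_apply`, `inner_Lap`); `lapResid k` =
   «R = ΔN(Q′_k)»; `Rproj k` = «R … an orthogonal projection on the linear subspace ΔN(Q′_k)» (1.38); the support of
   «δ_R(∂*A)»: **`Lan k := ker (R ∘ ∂*)`** = `{A : R∂*A = 0}` (`mem_Lan_iff`, and `mem_Lan_iff_inner`: `∀ λ ∈ N(Q′_k),
   ⟨∂*A, Δλ⟩ = 0`); the residual gauge orbit `orbit k = ∂N(Q′_k)`.
§3 THE TWO SLICES ARE SLICES: `isCompl_Lan_orbit` (every field is `A′ + ∂λ`, `λ ∈ N(Q′_k)`, `R∂*A′ = 0`, uniquely — the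
   existence half is «RΔλ = Δλ if Q′_kλ = 0», the uniqueness half is «Δ is positive definite on N(Q′_k)» in the form
   `Δλ = 0 ⇒ ∂λ = 0`), `isCompl_axAll_orbit` (p37's `hierGauge_exists/unique`), `orbit_le_ker` («δ(B − Q_kA) is invariant
   with respect to gauge transformations λ satisfying Q′_kλ = 0», p37's `Qk_Dg_eq_zero`), `exp_neg_actionEta_orbit`
   (`actionEta_gaugeR`).
§4 **(1.47)**: `rt47 k` := «∫dA δ(B − Q_kA)δ_R(∂*A) exp(−½⟨∂A, ∂A⟩)» as `deltaInt (Qk k) (Lan k) e^{−S^η}` («exp(−½⟨∂A,∂A⟩)» =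
   `e^{−S^η(A)}` by (1.21), r02's `actionEta`); `Eq147 k` := `∃ z″ > 0, ∀ B, ((ST)^k e^{−S})(B) = z″·rt47 k B` (the prefactor
   «z′^{(k)}∣det(Δ↾_{N(Q′_k)})∣» existential, as `z^{(k)}`/`z′^{(k)}` in r02's `Eq117`/`Eq123`); `rt17_eq_const_mul_rt47`
   (axial slice → Landau slice, §1); **`eq147_holds : 2 ≤ d → ∀ k, Eq147 L M k`** (from `B5Eq114Gauss.eq117_holds`);
   `rt47_pos`-type non-degeneracy is in `B5Eq165DeltaK`.

HONEST SCOPE / READINGS.  (i) The printed route (1.23) → (1.41) → (1.47) passes to the limit `α → 0` of the gauge-fixing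
density; the print itself offers the exact alternative «We may introduce this gauge from the beginning using the equation
(1.46)», i.e. insert a UNIT-MASS orbit weight concentrated on the Landau slice and repeat the manipulation of (1.23).  §1/§4
formalise exactly this exact route (axial slice ↔ Landau slice, both transversal to the residual orbit `∂N(Q′_k)`); the weak
limit (1.41) itself is the tree's `B5GaussSectC.tendsto_integral_calG_torus` and is not re-derived here.  (ii) «δ_R(∂*A)» is
typed by the (1.40) convention of `B5SectBStatements` (flat measure of the constraint subspace `{R∂*A = 0} ∩ {Q_kA = B}`,
translated; normalisations immaterial and absorbed in `z″`, exactly as the print absorbs them in «z′^{(k)}» and the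
determinant).  (iii) `R` is DEFINED as the orthogonal projection onto `ΔN(Q′_k)` (the printed characterisation p. 25); its
closed forms (1.38)/(1.44) are the tree's `B5Value126.PcT`/`B5Projector144.R144` on the one-stroke complex carrier and are not
re-derived on the tower.  (iv) U = 1, every `L ≥ 1`, every torus `M`, every `k`; `2 ≤ d` enters only through
`eq117_holds`.  Value = kernel certificate that the Gaussian of (1.17)/(1.19) IS the Landau-gauge integral (1.47) on one
carrier; NOT summit progress.
-/

open scoped BigOperators NNReal ENNReal InnerProductSpace
open MeasureTheory MeasureTheory.Measure

namespace Literature.MathematicalPhysics.QuantumFieldTheory.Balaban1983to89.B5Eq147Landau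

open B5SectBStatements B5Eq114Gauss B5HierGaugeTorus
open B5Prop11Plancherel (Tor fine unitVec)

noncomputable section

/-! ## §1  Exchanging the gauge slice in a δ-integral of linear constraints

«We may introduce this gauge from the beginning using the equation (1.46)» (p. 26): two subspaces `G₁`, `G₂` both
complementary to a space `O` of gauge directions along which the constraint `C` and the density are invariant give
proportional δ-integrals, the constant being a Jacobian independent of the density and of `B`. -/

section Exchange

variable {E : Type*} [NormedAddCommGroup E] [InnerProductSpace ℝ E] [FiniteDimensional ℝ E]
  [MeasurableSpace E] [BorelSpace E]
variable {F : Type*} [AddCommGroup F] [Module ℝ F]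
variable (C : E →ₗ[ℝ] F) {G₁ G₂ O : Submodule ℝ E}

omit [FiniteDimensional ℝ E] [MeasurableSpace E] [BorelSpace E] in
/-- the projection onto `G₂` along the gauge directions moves a point by a gauge direction (a gauge transformation
`λ ∈ N(Q′_k)` in (1.46)). [cite: Balaban1984PropagatorsI, (1.46) p.26] -/
theorem sub_projection_mem (h₂ : IsCompl G₂ O) (y : E) : y - G₂.projection O h₂ y ∈ O := by
  rw [← Submodule.projection_eq_self_sub_projection h₂ y]
  exact Submodule.projection_apply_mem h₂.symm y

omit [FiniteDimensional ℝ E] [MeasurableSpace E] [BorelSpace E] in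
/-- the constraint is blind to the projection along gauge directions: `C(π y) = C y`.
[cite: Balaban1984PropagatorsI, (1.20) p.20] -/
theorem apply_projection_eq (hO : O ≤ LinearMap.ker C) (h₂ : IsCompl G₂ O) (y : E) :
    C (G₂.projection O h₂ y) = C y := by
  have h : C (y - G₂.projection O h₂ y) = 0 := LinearMap.mem_ker.1 (hO (sub_projection_mem h₂ y))
  rw [map_sub, sub_eq_zero] at h
  exact h.symm

/-- the projection along `O`, restricted to the directions `N(C) ∩ G₁` (raw, `E`-valued): the change of gauge of (1.46)
on the fibre directions. [cite: Balaban1984PropagatorsI, (1.46) p.26] -/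
def sliceRaw (G₁ : Submodule ℝ E) (h₂ : IsCompl G₂ O) : dirSpace C G₁ →ₗ[ℝ] E :=
  (G₂.projection O h₂) ∘ₗ (dirSpace C G₁).subtype

omit [FiniteDimensional ℝ E] [MeasurableSpace E] [BorelSpace E] in
/-- pointwise. [cite: Balaban1984PropagatorsI, (1.46) p.26] -/
theorem sliceRaw_apply (h₂ : IsCompl G₂ O) (v : dirSpace C G₁) : sliceRaw C G₁ h₂ v = G₂.projection O h₂ (v : E) :=
  rfl

omit [FiniteDimensional ℝ E] [MeasurableSpace E] [BorelSpace E] in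
/-- it lands in the directions `N(C) ∩ G₂`. [cite: Balaban1984PropagatorsI, (1.46) p.26] -/
theorem sliceRaw_mem (hO : O ≤ LinearMap.ker C) (h₂ : IsCompl G₂ O) (v : dirSpace C G₁) :
    sliceRaw C G₁ h₂ v ∈ dirSpace C G₂ := by
  rw [sliceRaw_apply, mem_dirSpace_iff]
  refine ⟨?_, Submodule.projection_apply_mem h₂ _⟩
  rw [apply_projection_eq C hO h₂]
  exact ((mem_dirSpace_iff (v : E)).1 v.2).1

/-- the slice-to-slice map `N(C) ∩ G₁ → N(C) ∩ G₂` (change of gauge (1.46) on the fibre directions).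
[cite: Balaban1984PropagatorsI, (1.46) p.26] -/
def sliceMap (G₁ : Submodule ℝ E) (hO : O ≤ LinearMap.ker C) (h₂ : IsCompl G₂ O) :
    dirSpace C G₁ →ₗ[ℝ] dirSpace C G₂ :=
  (sliceRaw C G₁ h₂).codRestrict _ (sliceRaw_mem C hO h₂)

omit [FiniteDimensional ℝ E] [MeasurableSpace E] [BorelSpace E] in
/-- pointwise. [cite: Balaban1984PropagatorsI, (1.46) p.26] -/
theorem sliceMap_coe (hO : O ≤ LinearMap.ker C) (h₂ : IsCompl G₂ O) (v : dirSpace C G₁) :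
    ((sliceMap C G₁ hO h₂ v : dirSpace C G₂) : E) = G₂.projection O h₂ (v : E) :=
  rfl

omit [FiniteDimensional ℝ E] [MeasurableSpace E] [BorelSpace E] in
/-- the slice-to-slice map is a bijection (both `G₁`, `G₂` are complements of `O` inside which `N(C) ⊇ O`).
[cite: Balaban1984PropagatorsI, (1.46) p.26] -/
theorem sliceMap_bijective (hO : O ≤ LinearMap.ker C) (h₁ : IsCompl G₁ O) (h₂ : IsCompl G₂ O) :
    Function.Bijective (sliceMap C G₁ hO h₂) := by
  constructor
  · rw [← LinearMap.ker_eq_bot, LinearMap.ker_eq_bot']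
    intro v hv
    have hv' : G₂.projection O h₂ (v : E) = 0 := by
      have := congrArg (fun w : dirSpace C G₂ => (w : E)) hv
      simpa only [sliceMap_coe, Submodule.coe_zero] using this
    rw [Submodule.projection_apply_eq_zero_iff] at hv'
    have hG : (v : E) ∈ G₁ := ((mem_dirSpace_iff (v : E)).1 v.2).2
    have h0 : (v : E) = 0 := (Submodule.disjoint_def.1 h₁.disjoint) _ hG hv'
    exact Subtype.ext h0
  · intro w
    have hw := (mem_dirSpace_iff (w : E)).1 w.2
    set u : E := G₁.projection O h₁ (w : E) with hu
    have huO : (w : E) - u ∈ O := sub_projection_mem h₁ (w : E)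
    have hu1 : u ∈ dirSpace C G₁ := by
      rw [mem_dirSpace_iff]
      exact ⟨by rw [hu, apply_projection_eq C hO h₁, hw.1], Submodule.projection_apply_mem h₁ _⟩
    refine ⟨⟨u, hu1⟩, Subtype.ext ?_⟩
    rw [sliceMap_coe]
    have h3 : G₂.projection O h₂ ((w : E) - u) = 0 := (Submodule.projection_apply_eq_zero_iff h₂).2 huO
    rw [map_sub, sub_eq_zero, Submodule.projection_apply_of_mem_left h₂ hw.2] at h3
    exact h3.symm

/-- the slice-to-slice map as a continuous linear equivalence. [cite: Balaban1984PropagatorsI, (1.46) p.26] -/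
def sliceEquiv (hO : O ≤ LinearMap.ker C) (h₁ : IsCompl G₁ O) (h₂ : IsCompl G₂ O) :
    dirSpace C G₁ ≃L[ℝ] dirSpace C G₂ :=
  (LinearEquiv.ofBijective (sliceMap C G₁ hO h₂) (sliceMap_bijective C hO h₁ h₂)).toContinuousLinearEquiv

omit [MeasurableSpace E] [BorelSpace E] in
/-- pointwise. [cite: Balaban1984PropagatorsI, (1.46) p.26] -/
theorem sliceEquiv_coe (hO : O ≤ LinearMap.ker C) (h₁ : IsCompl G₁ O) (h₂ : IsCompl G₂ O) (v : dirSpace C G₁) :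
    ((sliceEquiv C hO h₁ h₂ v : dirSpace C G₂) : E) = G₂.projection O h₂ (v : E) := rfl

/-- **the Jacobian**: the slice-to-slice map carries the Euclidean volume of `N(C) ∩ G₁` to a positive multiple of the
Euclidean volume of `N(C) ∩ G₂` (the constant «z′^{(k)}∣det(Δ↾_{N(Q′_k)})∣/z^{(k)}» of (1.46)–(1.47) in the flat
normalisations). [cite: Balaban1984PropagatorsI, (1.46)–(1.47) p.26] -/
theorem exists_map_sliceEquiv (hO : O ≤ LinearMap.ker C) (h₁ : IsCompl G₁ O) (h₂ : IsCompl G₂ O) :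
    ∃ c : ℝ≥0, 0 < c ∧ Measure.map (sliceEquiv C hO h₁ h₂) volume = c • (volume : Measure (dirSpace C G₂)) := by
  haveI : IsAddHaarMeasure (Measure.map (sliceEquiv C hO h₁ h₂) (volume : Measure (dirSpace C G₁))) :=
    (sliceEquiv C hO h₁ h₂).isAddHaarMeasure_map _
  exact ⟨_, addHaarScalarFactor_pos_of_isAddHaarMeasure _ _, isAddLeftInvariant_eq_smul _ _⟩

/-- **EXCHANGE OF THE GAUGE SLICE**: for every density invariant under the gauge directions `O ≤ N(C)` and every `B`,
`∫dA δ(B − CA) δ_{G₁}(A) ρ(A) = c·∫dA δ(B − CA) δ_{G₂}(A) ρ(A)` with ONE constant `c > 0` depending only on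
`(C, O, G₁, G₂)` — the typed content of «We may introduce this gauge from the beginning using the equation (1.46)» (a
unit-mass orbit weight concentrated on another slice transversal to the residual gauge orbit).
[cite: Balaban1984PropagatorsI, (1.46) p.26] -/
theorem deltaInt_exchange (hO : O ≤ LinearMap.ker C) (h₁ : IsCompl G₁ O) (h₂ : IsCompl G₂ O) :
    ∃ c : ℝ, 0 < c ∧ ∀ ρ : E → ℝ, (∀ (A : E), ∀ g ∈ O, ρ (A + g) = ρ A) →
      ∀ B : F, deltaInt C G₁ ρ B = c * deltaInt C G₂ ρ B := by
  obtain ⟨c, hc, hmap⟩ := exists_map_sliceEquiv C hO h₁ h₂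
  refine ⟨c, NNReal.coe_pos.2 hc, fun ρ hρ B => ?_⟩
  set Φ := sliceEquiv C hO h₁ h₂ with hΦ
  -- invariance in the form `ρ y = ρ (π y)`
  have hπ : ∀ y : E, ρ y = ρ (G₂.projection O h₂ y) := by
    intro y
    have h := hρ (G₂.projection O h₂ y) (y - G₂.projection O h₂ y) (sub_projection_mem h₂ y)
    rwa [add_sub_cancel] at h
  by_cases hne : (fibre C G₁ B).Nonempty
  · obtain ⟨A₁, hA₁⟩ := hne
    have hA₂ : G₂.projection O h₂ A₁ ∈ fibre C G₂ B :=
      ⟨by rw [apply_projection_eq C hO h₂, hA₁.1], Submodule.projection_apply_mem h₂ _⟩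
    rw [deltaInt_eq ρ hA₁, deltaInt_eq ρ hA₂]
    set g : dirSpace C G₂ → ℝ := fun w => ρ (G₂.projection O h₂ A₁ + (w : E)) with hg
    have hfun : (fun v : dirSpace C G₁ => ρ (A₁ + (v : E))) = fun v => g (Φ v) := by
      funext v
      rw [hπ (A₁ + (v : E))]
      simp only [hg]
      rw [hΦ, sliceEquiv_coe, map_add]
    rw [hfun]
    let Φm := Φ.toHomeomorph.toMeasurableEquiv
    have hΦm : (Φm : dirSpace C G₁ → dirSpace C G₂) = Φ := rfl
    calc ∫ v : dirSpace C G₁, g (Φ v) = ∫ v : dirSpace C G₁, g (Φm v) := by rw [hΦm]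
      _ = ∫ w, g w ∂(Measure.map Φm volume) := (integral_map_equiv Φm g).symm
      _ = c * ∫ w, g w := by rw [hΦm, hmap, integral_smul_nnreal_measure, NNReal.smul_def, smul_eq_mul]
  · have hne' : ¬ (fibre C G₂ B).Nonempty := by
      rintro ⟨A₂, hA₂⟩
      exact hne ⟨G₁.projection O h₁ A₂, by rw [apply_projection_eq C hO h₁, hA₂.1], Submodule.projection_apply_mem h₁ _⟩
    rw [deltaInt_of_isEmpty _ hne, deltaInt_of_isEmpty _ hne', mul_zero]

end Exchange

/-! ## §2  The Landau gauge on level `k` of the tower: `∂*`, `Δ = ∂*∂`, `R = ΔN(Q′_k)`, and `{A : R∂*A = 0}` -/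

section Landau

variable {d : ℕ} (L : ℕ) (M : Fin d → ℕ) [NeZero L] [hM : ∀ μ, NeZero (M μ)]

/-- **`∂*`** — «∂* is the divergence operator for vector functions, ∂*A = Σ_μ ∂*_μA_μ» (p. 21), on level `k` of the tower
(`η = L^{−k}`): the adjoint of the gradient `∂^{L^k}` (`B5HierGaugeTorus.Dg`) for the Euclidean structures of
`B5SectBStatements.Fld/Scl` (the uniform weights `η^d` of `L²(T_η)` do not change adjoints); explicit formula `Dv_apply`.
[cite: Balaban1984PropagatorsI, (1.21) p.21] -/
def Dv (k : ℕ) : Fld (towerM L M k) →ₗ[ℝ] Scl (towerM L M k) := LinearMap.adjoint (Dg L M k)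

/-- adjointness `⟨∂λ, A⟩ = ⟨λ, ∂*A⟩`. [cite: Balaban1984PropagatorsI, (1.21) p.21] -/
theorem inner_Dg_left (k : ℕ) (l : Scl (towerM L M k)) (A : Fld (towerM L M k)) :
    ⟪Dg L M k l, A⟫_ℝ = ⟪l, Dv L M k A⟫_ℝ := by
  rw [Dv, LinearMap.adjoint_inner_right]

/-- **`∂*` is the lattice divergence**: `(∂*A)(x) = L^k·Σ_μ (A_μ(x − ηe_μ) − A_μ(x))` (backward differences; the tree's
complex `B5Action121.divS` has the same formula). [cite: Balaban1984PropagatorsI, (1.21) p.21] -/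
theorem Dv_apply (k : ℕ) (A : Fld (towerM L M k)) (x : Tor (towerM L M k)) :
    Dv L M k A x = (L : ℝ) ^ k * ∑ μ : Fin d, (A (x - unitVec (towerM L M k) μ, μ) - A (x, μ)) := by
  classical
  set N := towerM L M k with hN
  -- the explicit backward-difference map `∂*`
  let dv : Fld N → Tor N → ℝ := fun A x => (L : ℝ) ^ k * ∑ μ : Fin d, (A (x - unitVec N μ, μ) - A (x, μ))
  let D' : Fld N →ₗ[ℝ] Scl N :=
    { toFun := fun A => WithLp.toLp 2 (dv A)
      map_add' := by
        intro A A'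
        ext x
        simp only [dv, PiLp.add_apply]
        rw [← mul_add, ← Finset.sum_add_distrib]
        congr 1
        refine Finset.sum_congr rfl fun μ _ => ?_
        ring
      map_smul' := by
        intro a A
        ext x
        simp only [dv, PiLp.smul_apply, smul_eq_mul, RingHom.id_apply, Finset.mul_sum]
        refine Finset.sum_congr rfl fun μ _ => ?_
        ring }
  have hD'x : ∀ (A : Fld N) (x : Tor N), D' A x = dv A x := fun A x => rfl
  -- adjointness of the explicit map: summation by parts on the torus
  have hadj : ∀ (l : Scl N) (A : Fld N), ⟪Dg L M k l, A⟫_ℝ = ⟪l, D' A⟫_ℝ := by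
    intro l A
    simp only [PiLp.inner_apply, RCLike.inner_apply, conj_trivial, hD'x]
    rw [Fintype.sum_prod_type, Finset.sum_comm]
    -- both sides as `Σ_μ Σ_x`
    have hR : ∑ x : Tor N, dv A x * l x
        = ∑ μ : Fin d, ∑ x : Tor N, ((L : ℝ) ^ k * (A (x - unitVec N μ, μ) - A (x, μ))) * l x := by
      rw [Finset.sum_comm]
      refine Finset.sum_congr rfl fun x _ => ?_
      simp only [dv, Finset.mul_sum, Finset.sum_mul]
    rw [hR]
    refine Finset.sum_congr rfl fun μ _ => ?_
    have hshift : ∑ x : Tor N, A (x, μ) * l (x + unitVec N μ) = ∑ x : Tor N, A (x - unitVec N μ, μ) * l x :=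
      Fintype.sum_equiv (Equiv.addRight (unitVec N μ)) _ _ fun x => by
        simp only [Equiv.coe_addRight, add_sub_cancel_right]
    have hDg : ∀ x : Tor N, Dg L M k l (x, μ) = (L : ℝ) ^ k * (l (x + unitVec N μ) - l x) := fun x => by
      rw [Dg, Dgrad_apply]
    calc ∑ x : Tor N, A (x, μ) * Dg L M k l (x, μ)
        = (L : ℝ) ^ k * (∑ x : Tor N, A (x, μ) * l (x + unitVec N μ) - ∑ x : Tor N, A (x, μ) * l x) := by
          rw [← Finset.sum_sub_distrib, Finset.mul_sum]
          refine Finset.sum_congr rfl fun x _ => ?_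
          rw [hDg]
          ring
      _ = (L : ℝ) ^ k * (∑ x : Tor N, A (x - unitVec N μ, μ) * l x - ∑ x : Tor N, A (x, μ) * l x) := by rw [hshift]
      _ = ∑ x : Tor N, ((L : ℝ) ^ k * (A (x - unitVec N μ, μ) - A (x, μ))) * l x := by
          rw [← Finset.sum_sub_distrib, Finset.mul_sum]
          refine Finset.sum_congr rfl fun x _ => ?_
          ring
  have hD : Dv L M k = D' := by
    rw [Dv]
    symm
    rw [LinearMap.eq_adjoint_iff]
    intro A l
    rw [real_inner_comm, ← hadj, real_inner_comm]
  rw [hD, hD'x]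

/-- **`Δ = ∂*∂`** — «Δ is η-lattice Laplace operator for scalar functions» (p. 21; the positive Laplacian of (1.21),
`Σ_μ⟨A_μ, ΔA_μ⟩ − ⟨∂*A, ∂*A⟩`), on level `k` of the tower. [cite: Balaban1984PropagatorsI, (1.21) p.21] -/
def Lap (k : ℕ) : Scl (towerM L M k) →ₗ[ℝ] Scl (towerM L M k) := Dv L M k ∘ₗ Dg L M k

/-- `⟨λ, Δλ′⟩ = ⟨∂λ, ∂λ′⟩` (`Δ = ∂*∂`). [cite: Balaban1984PropagatorsI, (1.21) p.21] -/
theorem inner_Lap (k : ℕ) (l l' : Scl (towerM L M k)) :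
    ⟪l, Lap L M k l'⟫_ℝ = ⟪Dg L M k l, Dg L M k l'⟫_ℝ := by
  rw [Lap, LinearMap.comp_apply, ← inner_Dg_left]

/-- `Δ` is symmetric. [cite: Balaban1984PropagatorsI, Sect. C p.22] -/
theorem Lap_symm (k : ℕ) (l l' : Scl (towerM L M k)) : ⟪Lap L M k l, l'⟫_ℝ = ⟪l, Lap L M k l'⟫_ℝ := by
  rw [real_inner_comm, inner_Lap, inner_Lap, real_inner_comm]

/-- `⟨λ, Δλ⟩ = ‖∂λ‖² ≥ 0`: `Δ ≥ 0`, and `Δλ = 0` forces `∂λ = 0` (kernel = constants on a connected torus).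
[cite: Balaban1984PropagatorsI, Sect. C p.22] -/
theorem inner_Lap_self (k : ℕ) (l : Scl (towerM L M k)) : ⟪l, Lap L M k l⟫_ℝ = ‖Dg L M k l‖ ^ 2 := by
  rw [inner_Lap, real_inner_self_eq_norm_sq]

/-- `Δλ = 0 ⇒ ∂λ = 0`. [cite: Balaban1984PropagatorsI, Sect. C p.22] -/
theorem Dg_eq_zero_of_Lap_eq_zero (k : ℕ) {l : Scl (towerM L M k)} (h : Lap L M k l = 0) : Dg L M k l = 0 := by
  have h2 : ‖Dg L M k l‖ ^ 2 = 0 := by rw [← inner_Lap_self, h, inner_zero_right]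
  exact norm_eq_zero.1 (pow_eq_zero_iff two_ne_zero |>.1 h2)

/-- the explicit second-difference formula `(Δλ)(x) = L^{2k}·Σ_μ (2λ(x) − λ(x + ηe_μ) − λ(x − ηe_μ))` (the tree's complex
`B5Action121.LapS` has the same formula). [cite: Balaban1984PropagatorsI, (1.21) p.21] -/
theorem Lap_apply (k : ℕ) (l : Scl (towerM L M k)) (x : Tor (towerM L M k)) :
    Lap L M k l x = ((L : ℝ) ^ k) ^ 2 *
      ∑ μ : Fin d, (2 * l x - l (x + unitVec (towerM L M k) μ) - l (x - unitVec (towerM L M k) μ)) := by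
  rw [Lap, LinearMap.comp_apply, Dv_apply]
  simp only [Dg, Dgrad_apply, sub_add_cancel]
  rw [sq, mul_assoc, Finset.mul_sum, Finset.mul_sum, Finset.mul_sum]
  refine Finset.sum_congr rfl fun μ _ => ?_
  ring

/-- **«R = ΔN(Q′_k)»**: the subspace `Δ(N(Q′_k))` of `L²(T_η)`, `N(Q′_k) = {λ : Q′_kλ = 0}` (composite `Q′_k` of the tower).
[cite: Balaban1984PropagatorsI, (1.38) p.24, p.25 (text)] -/
def lapResid (k : ℕ) : Submodule ℝ (Scl (towerM L M k)) := (LinearMap.ker (Qsk L M k)).map (Lap L M k)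

/-- membership: `ω ∈ ΔN(Q′_k) ↔ ω = Δλ` for some `λ` with `Q′_kλ = 0`. [cite: Balaban1984PropagatorsI, p.25 (text)] -/
theorem mem_lapResid_iff (k : ℕ) (ω : Scl (towerM L M k)) :
    ω ∈ lapResid L M k ↔ ∃ l : Scl (towerM L M k), Qsk L M k l = 0 ∧ Lap L M k l = ω := by
  simp only [lapResid, Submodule.mem_map, LinearMap.mem_ker]

/-- **`R`** — «It is an orthogonal projection on the linear subspace ΔN(Q′_k) of L²(T_η)» (p. 25; closed forms (1.38),
(1.44) on the one-stroke carrier are the tree's `B5Value126.PcT`/`B5Projector144.R144`, not re-derived here).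
[cite: Balaban1984PropagatorsI, (1.38) p.24, p.25 (text)] -/
def Rproj (k : ℕ) : Scl (towerM L M k) →L[ℝ] Scl (towerM L M k) := (lapResid L M k).starProjection

/-- «Indeed RΔλ = Δλ if Q′_kλ = 0» (p. 25). [cite: Balaban1984PropagatorsI, p.25 (text)] -/
theorem Rproj_Lap_of_mem_ker (k : ℕ) {l : Scl (towerM L M k)} (hl : Qsk L M k l = 0) :
    Rproj L M k (Lap L M k l) = Lap L M k l :=
  Submodule.starProjection_eq_self_iff.2 ((mem_lapResid_iff L M k _).2 ⟨l, hl, rfl⟩)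

/-- `Rω = 0 ↔ ω ⊥ ΔN(Q′_k)`. [cite: Balaban1984PropagatorsI, p.25 (text)] -/
theorem Rproj_eq_zero_iff (k : ℕ) (ω : Scl (towerM L M k)) : Rproj L M k ω = 0 ↔ ω ∈ (lapResid L M k)ᗮ := by
  rw [Rproj, Submodule.starProjection_apply, Submodule.coe_eq_zero, Submodule.orthogonalProjectionOnto_eq_zero_iff]

/-- **THE LANDAU GAUGE `{A : R∂*A = 0}`** — the support of «δ_R(∂*A)» in (1.46)/(1.47) («δ_R is a δ-function concentrated at
the origin of the sub-space R», p. 25): the kernel of `R∘∂*` on level `k` of the tower.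
[cite: Balaban1984PropagatorsI, (1.47) p.26, (1.41) p.25] -/
def Lan (k : ℕ) : Submodule ℝ (Fld (towerM L M k)) := LinearMap.ker ((Rproj L M k).toLinearMap ∘ₗ Dv L M k)

/-- membership: `A ∈ Lan k ↔ R∂*A = 0`. [cite: Balaban1984PropagatorsI, (1.47) p.26] -/
theorem mem_Lan_iff (k : ℕ) (A : Fld (towerM L M k)) : A ∈ Lan L M k ↔ Rproj L M k (Dv L M k A) = 0 := Iff.rfl

/-- membership, carrier-free: `R∂*A = 0 ↔ ⟨∂*A, Δλ⟩ = 0` for every `λ ∈ N(Q′_k)` (`∂*A ⊥ ΔN(Q′_k)`).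
[cite: Balaban1984PropagatorsI, (1.47) p.26, p.25 (text)] -/
theorem mem_Lan_iff_inner (k : ℕ) (A : Fld (towerM L M k)) :
    A ∈ Lan L M k ↔ ∀ l : Scl (towerM L M k), Qsk L M k l = 0 → ⟪Dv L M k A, Lap L M k l⟫_ℝ = 0 := by
  rw [mem_Lan_iff, Rproj_eq_zero_iff, Submodule.mem_orthogonal']
  constructor
  · intro h l hl
    exact h _ ((mem_lapResid_iff L M k _).2 ⟨l, hl, rfl⟩)
  · intro h ω hω
    obtain ⟨l, hl, rfl⟩ := (mem_lapResid_iff L M k ω).1 hω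
    exact h l hl

/-- membership through the gradient: `A ∈ Lan k ↔ ⟨A, ∂Δλ⟩ = 0` for every `λ ∈ N(Q′_k)` (`A ⊥ ∂ΔN(Q′_k)`).
[cite: Balaban1984PropagatorsI, (1.47) p.26] -/
theorem mem_Lan_iff_inner_Dg (k : ℕ) (A : Fld (towerM L M k)) :
    A ∈ Lan L M k ↔ ∀ l : Scl (towerM L M k), Qsk L M k l = 0 → ⟪A, Dg L M k (Lap L M k l)⟫_ℝ = 0 := by
  rw [mem_Lan_iff_inner]
  refine forall_congr' fun l => forall_congr' fun _ => ?_
  rw [real_inner_comm, ← inner_Dg_left, real_inner_comm]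

/-- **the residual gauge orbit directions `∂N(Q′_k)`** («gauge transformations λ satisfying the condition Q′_kλ = 0», p. 20).
[cite: Balaban1984PropagatorsI, (1.20) p.20, (1.22) p.21] -/
def orbit (k : ℕ) : Submodule ℝ (Fld (towerM L M k)) := (LinearMap.ker (Qsk L M k)).map (Dg L M k)

omit [NeZero L] hM in
/-- membership: `g ∈ ∂N(Q′_k) ↔ g = ∂λ`, `Q′_kλ = 0`. [cite: Balaban1984PropagatorsI, (1.20) p.20] -/
theorem mem_orbit_iff (k : ℕ) (g : Fld (towerM L M k)) :
    g ∈ orbit L M k ↔ ∃ l : Scl (towerM L M k), Qsk L M k l = 0 ∧ Dg L M k l = g := by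
  simp only [orbit, Submodule.mem_map, LinearMap.mem_ker]

/-! ## §3  The axial and the Landau subspaces are both slices of the residual gauge orbit -/

/-- **`Fld = Lan ⊕ ∂N(Q′_k)`**: every field is uniquely `A′ + ∂λ` with `R∂*A′ = 0`, `Q′_kλ = 0` — existence: `Δλ := R∂*A ∈
ΔN(Q′_k)` is solvable and «RΔλ = Δλ if Q′_kλ = 0»; uniqueness: «Δ is positive definite on N(Q′_k)» in the form
`Δλ = 0 ⇒ ∂λ = 0`. [cite: Balaban1984PropagatorsI, p.25 (text), (1.46) p.26] -/
theorem isCompl_Lan_orbit (k : ℕ) : IsCompl (Lan L M k) (orbit L M k) := by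
  refine IsCompl.of_eq ?_ ?_
  · rw [Submodule.eq_bot_iff]
    intro A hA
    obtain ⟨hL, hO⟩ := Submodule.mem_inf.1 hA
    obtain ⟨l, hl, rfl⟩ := (mem_orbit_iff L M k A).1 hO
    have h1 : Rproj L M k (Dv L M k (Dg L M k l)) = 0 := (mem_Lan_iff L M k _).1 hL
    have h2 : Dv L M k (Dg L M k l) = Lap L M k l := rfl
    rw [h2, Rproj_Lap_of_mem_ker L M k hl] at h1
    exact Dg_eq_zero_of_Lap_eq_zero L M k h1
  · rw [Submodule.eq_top_iff']
    intro A
    have hR : Rproj L M k (Dv L M k A) ∈ lapResid L M k := by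
      rw [Rproj, Submodule.starProjection_apply]
      exact SetLike.coe_mem _
    obtain ⟨l, hl, hlap⟩ := (mem_lapResid_iff L M k _).1 hR
    refine Submodule.mem_sup.2 ⟨A - Dg L M k l, ?_, Dg L M k l, (mem_orbit_iff L M k _).2 ⟨l, hl, rfl⟩,
      sub_add_cancel _ _⟩
    rw [mem_Lan_iff, map_sub, map_sub]
    have h2 : Dv L M k (Dg L M k l) = Lap L M k l := rfl
    rw [h2, Rproj_Lap_of_mem_ker L M k hl, hlap, sub_self]

/-- **`Fld = AxAll ⊕ ∂N(Q′_k)`**: the hierarchical block-axial gauge (p37's `B5HierGaugeTorus.hierGauge_exists/unique`) read as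
a direct-sum decomposition. [cite: Balaban1984PropagatorsI, (1.17) p.20, (1.23) p.21] -/
theorem isCompl_axAll_orbit (k : ℕ) : IsCompl (AxAll L M k) (orbit L M k) := by
  refine IsCompl.of_eq ?_ ?_
  · rw [Submodule.eq_bot_iff]
    intro A hA
    obtain ⟨hAx, hO⟩ := Submodule.mem_inf.1 hA
    obtain ⟨l, hl, rfl⟩ := (mem_orbit_iff L M k A).1 hO
    have h1 : gaugeR L M k (Dg L M k l) l ∈ AxAll L M k := by
      rw [gaugeR_eq_sub_Dg, sub_self]; exact Submodule.zero_mem _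
    have h2 : gaugeR L M k (Dg L M k l) 0 ∈ AxAll L M k := by
      rw [gaugeR_eq_sub_Dg, map_zero, sub_zero]; exact hAx
    have h3 : l = 0 := hierGauge_unique L M k (Dg L M k l) l 0 hl h1 (map_zero _) h2
    rw [h3, map_zero]
  · rw [Submodule.eq_top_iff']
    intro A
    obtain ⟨l, hl, hAx⟩ := hierGauge_exists L M k A
    refine Submodule.mem_sup.2 ⟨gaugeR L M k A l, hAx, Dg L M k l, (mem_orbit_iff L M k _).2 ⟨l, hl, rfl⟩, ?_⟩
    rw [gaugeR_eq_sub_Dg, sub_add_cancel]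

/-- «The δ-function δ(B − Q_kA) is invariant with respect to gauge transformations λ satisfying the condition Q′_kλ = 0»:
`∂N(Q′_k) ⊆ N(Q_k)` (p37's `Qk_Dg_eq_zero`). [cite: Balaban1984PropagatorsI, (1.20) p.20] -/
theorem orbit_le_ker (k : ℕ) : orbit L M k ≤ LinearMap.ker (Qk L M k) := by
  intro g hg
  obtain ⟨l, hl, rfl⟩ := (mem_orbit_iff L M k g).1 hg
  exact LinearMap.mem_ker.2 (Qk_Dg_eq_zero L M k hl)

omit [NeZero L] hM in
/-- `A + ∂λ` is the gauge transform `A^{−λ}`. [cite: Balaban1984PropagatorsI, (1.20) p.20] -/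
theorem add_Dg_eq_gaugeR (k : ℕ) (A : Fld (towerM L M k)) (l : Scl (towerM L M k)) :
    A + Dg L M k l = gaugeR L M k A (-l) := by
  rw [gaugeR_eq_sub_Dg, map_neg, sub_neg_eq_add]

/-- the density `e^{−S^η}` is invariant along the residual orbit («all the expressions in the integral (1.17) with the exception
of gauge fixing terms δ_Ax are invariant», p. 21; `B5HierGaugeTorus.actionEta_gaugeR`). [cite: Balaban1984PropagatorsI, (1.22) p.21] -/
theorem exp_neg_actionEta_orbit (k : ℕ) (A : Fld (towerM L M k)) (g : Fld (towerM L M k)) (hg : g ∈ orbit L M k) :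
    Real.exp (-actionEta L M k (A + g)) = Real.exp (-actionEta L M k A) := by
  obtain ⟨l, -, rfl⟩ := (mem_orbit_iff L M k g).1 hg
  rw [add_Dg_eq_gaugeR, actionEta_gaugeR]

/-! ## §4  (1.47): the k-fold transformation as the Landau-gauge integral -/

/-- **the integral of (1.47)** «∫dA δ(B − Q_kA) δ_R(∂*A) exp(−½⟨∂A, ∂A⟩)» on level `k` of the tower: the δ-integral
(convention (1.40) of `B5SectBStatements`) of `e^{−S^η}` («½⟨∂A, ∂A⟩ = S^η(A)», (1.21)) over the fibre `{A : Q_kA = B}` inside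
the Landau gauge `{R∂*A = 0}`; the prefactor «z′^{(k)}∣det(Δ↾_{N(Q′_k)})∣» is kept outside (cf. `Eq147`).
[cite: Balaban1984PropagatorsI, (1.47) p.26] -/
def rt47 (k : ℕ) : Fld M → ℝ := deltaInt (Qk L M k) (Lan L M k) fun A => Real.exp (-actionEta L M k A)

/-- **(1.47) CLAIM** p. 26 [PDF 10], verbatim: *"We have to calculate the integral ((ST)^k e^{−S})(B) =
z′^{(k)}∣det(Δ↾_{N(Q′_k)})∣∫dA δ(B − Q_kA)δ_R(∂*A) exp(−½⟨∂A, ∂A⟩). (1.47)"* — typed reading on the tower: the k-fold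
transformation `(ST)^k` of `B5SectBStatements.iterST` applied to the Gibbs density of the unit-lattice action (1.5)
equals `z″·rt47 k` for a numerical factor `z″ > 0` (= «z′^{(k)}∣det(Δ↾_{N(Q′_k)})∣» in the flat normalisations of the
δ-measures, existential as in `Eq117`/`Eq123`). [cite: Balaban1984PropagatorsI, (1.47) p.26] -/
def Eq147 (k : ℕ) : Prop :=
  ∃ z : ℝ, 0 < z ∧ ∀ B : Fld M, iterST L M k (fun A => Real.exp (-action1 A)) B = z * rt47 L M k B

/-- **AXIAL SLICE → LANDAU SLICE**: `∫dA δ(B − Q_kA)δ_Ax(Q_{k−1}A)⋯δ_Ax(A)e^{−S^η(A)} = c·∫dA δ(B − Q_kA)δ_R(∂*A)e^{−S^η(A)}` with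
one constant `c > 0` for all `B` (§1 with `O = ∂N(Q′_k)`, `G₁ = AxAll`, `G₂ = Lan`).
[cite: Balaban1984PropagatorsI, (1.46)–(1.47) p.26] -/
theorem rt17_eq_const_mul_rt47 (k : ℕ) : ∃ c : ℝ, 0 < c ∧ ∀ B : Fld M, rt17 L M k B = c * rt47 L M k B := by
  obtain ⟨c, hc, h⟩ := deltaInt_exchange (Qk L M k) (orbit_le_ker L M k) (isCompl_axAll_orbit L M k)
    (isCompl_Lan_orbit L M k)
  exact ⟨c, hc, fun B => h _ (fun A g hg => exp_neg_actionEta_orbit L M k A g hg) B⟩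

/-- (1.47) from (1.17): bookkeeping. [cite: Balaban1984PropagatorsI, (1.47) p.26] -/
theorem eq147_of_eq117 (k : ℕ) (h117 : Eq117 L M k) : Eq147 L M k := by
  obtain ⟨z, hz, hzB⟩ := h117
  obtain ⟨c, hc, hcB⟩ := rt17_eq_const_mul_rt47 L M k
  refine ⟨z * c, mul_pos hz hc, fun B => ?_⟩
  rw [hzB B, hcB B, mul_assoc]

/-- **(1.47) PROVED for every `k`** (d ≥ 2, every `L ≥ 1`, every torus, U = 1): `((ST)^k e^{−S})(B) =
z″·∫dA δ(B − Q_kA) δ_R(∂*A) exp(−½⟨∂A, ∂A⟩)`. [cite: Balaban1984PropagatorsI, (1.47) p.26] -/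
theorem eq147_holds (hd : 2 ≤ d) (k : ℕ) : Eq147 L M k := eq147_of_eq117 L M k (eq117_holds L M hd k)

/-- (1.47) read together with (1.19): the Landau-gauge integral IS the Gaussian of `B5Eq114Gauss.DeltaK`, up to a constant:
`rt47 k B = c·exp(−½⟨B, Δ_kB⟩)`, `c > 0` (d ≥ 2). [cite: Balaban1984PropagatorsI, (1.47) p.26, (1.19) p.20] -/
theorem rt47_gauss (hd : 2 ≤ d) (k : ℕ) :
    ∃ c : ℝ, 0 < c ∧ ∀ B : Fld M, rt47 L M k B = c * Real.exp (-S1 M (DeltaK L M k) B) := by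
  obtain ⟨c, hc, hcB⟩ := rt17_eq_const_mul_rt47 L M k
  refine ⟨c⁻¹ * Zk L M k, mul_pos (inv_pos.2 hc) (Zk_pos L M hd k), fun B => ?_⟩
  have h := hcB B
  rw [rt17_gauss] at h
  rw [mul_assoc, h, ← mul_assoc, inv_mul_cancel₀ hc.ne', one_mul]

end Landau

end

end Literature.MathematicalPhysics.QuantumFieldTheory.Balaban1983to89.B5Eq147Landau
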